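import Literature.NumberTheory.GaloisRepresentations.LubinTateUnramifiedAnomalyCokernelExact
import HarnessLib

/-!
# De Shalit's Theorem I.3.7 over the unramified base at `q = 2`, as ONE exact sequence in coordinates:
# `0 → 𝒰¹(E·K_π^∞) —(β ↦ r_β)→ 𝒪_E⟦Y⟧ —J→ 𝒪_F/(1 − u^{[E:F]}) → 0`

De Shalit, *Iwasawa theory of elliptic curves with complex multiplication* (1987), Ch. I §3.7 Theorem: `0 → 𝒰 ⊗̂ 𝒪 →ⁱ Λ(𝒢, 𝒪) →ʲ (𝒪/p^N)(1) → 0`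
is exact, `p^N ∥ p^dξ^{-1} − 1`.  This file assembles the tree's coordinate form at `q = 2` (`π = 2u`, `π ≡ m₁ (mod π²)`, `E ⊆ F^{nr}` finite
Galois of degree `d` with Frobenius `φ`, `u^d ≠ 1` i.e. `N < ∞`): with `J(r) := λ(r(0)) mod (1 − u^d)` (`λ` the functional of
`LubinTateUnramifiedAnomalyCokernelExact`),

* ★★ `exists_exact_relUnitCoordTwo` — **`J : 𝒪_E⟦Y⟧ → 𝒪_F/(1 − u^d)` is `𝒪_F`-linear and SURJECTIVE, and `J(r) = 0` iff `r = r_β` for a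
  PRINCIPAL norm-coherent unit `β` along `E·K_π^∞`** (image: `exists_principal_relUnitCoordTwo_eq` / `constantCoeff_relUnitCoordTwo`;
  cokernel: `exists_functional_anomaly_cokernel`);
* ★ `existsUnique_principal_of_exists` (`char F = 0`) — the `β` is UNIQUE (`eq_of_relUnitCoordTwo_eq_of_norm_sub_one_lt` with
  `eq_zero_of_eq_mul_frobUnitBall`): the sequence is exact on the left as well.

Everything PROVED (0 sorry, no named facts).

## References

* E. de Shalit, *Iwasawa theory of elliptic curves with complex multiplication* (1987), Ch. I §3.7 Theorem. [deShalit1987]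
-/

noncomputable section

open scoped PowerSeries.WithPiTopology

namespace Literature.NumberTheory.GaloisRepresentations

section RelativeExactSequenceTwo

open GaloisRepresentations.IsNonarchimedeanLocalField LubinTate ValuativeRel Field

variable {F : Type} [Field F] [ValuativeRel F] [TopologicalSpace F] [IsNonarchimedeanLocalField F]

attribute [local instance] ltNormUniformSpace ltNormIsUniformAddGroup rk1 nF nE fintypeResidueField

variable {π : 𝒪[F]} (hπ : (valuation F).IsUniformizer (π : F))
variable (E : IntermediateField F (AlgebraicClosure F)) [FiniteDimensional F E] [Normal F E] [IsGalois F E]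
  (hq : residueFieldCard F = 2) (hE : E ≤ maxUnramified F) {σ₀ : absoluteGaloisGroup F} (hσ₀ : IsAbsArithFrob σ₀)

omit [Normal F E] [IsGalois F E] in
/-- The two coefficient maps `LTCoeff F → 𝒪_E` and `𝒪_F → 𝒪_E` agree. [folklore] -/
private theorem algebraMap_LTCoeff_eq (u : LTCoeff F) :
    algebraMap (LTCoeff F) (unitBall E) u = algebraMap 𝒪[F] (unitBall E) ((LTCoeff.of F).symm u) := by
  change algebraMap (LTCoeff F) (unitBall E) u = algebraMap (LTCoeff F) (unitBall E) ((LTCoeff.of F) ((LTCoeff.of F).symm u))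
  rw [RingEquiv.apply_symm_apply]

set_option maxHeartbeats 800000 in
/-- ★★ **Theorem I.3.7 over `k' = E` at `q = 2` as an exact sequence `𝒰¹(E·K_π^∞) → 𝒪_E⟦Y⟧ → 𝒪_F/(1 − u^{[E:F]}) → 0`**: there is a
surjective `𝒪_F`-linear map `J : 𝒪_E⟦Y⟧ → 𝒪_F/(1 − u^{[E:F]})` (namely `r ↦ λ(r(0))`) whose kernel is EXACTLY the set of coordinates
`r_β` of principal norm-coherent units `β` (`π = 2u`, `π ≡ m₁ (mod π²)`, `u^{[E:F]} ≠ 1`). [cite: deShalit1987, Ch. I §3.7 Theorem] -/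
theorem exists_exact_relUnitCoordTwo (u : (LTCoeff F)ˣ) (hu : LTCoeff.of F π = residueFieldCard F * u)
    (hm : ∃ m₁ : ℕ, LTCoeff.of F π ^ 2 ∣ LTCoeff.of F π - m₁)
    (hud : 1 - (LTCoeff.of F).symm (u : LTCoeff F) ^ Module.finrank F E ≠ 0) :
    ∃ J : PowerSeries (unitBall E) →+ 𝒪[F] ⧸ Ideal.span {1 - (LTCoeff.of F).symm (u : LTCoeff F) ^ Module.finrank F E},
      (∀ (a : 𝒪[F]) (r : PowerSeries (unitBall E)), J (PowerSeries.C (algebraMap 𝒪[F] (unitBall E) a) * r) = a • J r) ∧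
      Function.Surjective J ∧
      ∀ r : PowerSeries (unitBall E),
        (∃ β : RelNormCoherentUnits hπ E,
          ‖((β.val 0 : unitBall (E ⊔ ltField π 0 : IntermediateField F (AlgebraicClosure F))) :
            (E ⊔ ltField π 0 : IntermediateField F (AlgebraicClosure F))) - 1‖ < 1 ∧
          relUnitCoordTwo hπ E hq hE hσ₀ u hu β = r) ↔ J r = 0 := by
  obtain ⟨lam, hsurj, hiff⟩ := exists_functional_anomaly_cokernel hπ E hE hσ₀ ((LTCoeff.of F).symm (u : LTCoeff F)) hud
  obtain ⟨I, hI⟩ : ∃ I : Ideal 𝒪[F], I = Ideal.span {1 - (LTCoeff.of F).symm (u : LTCoeff F) ^ Module.finrank F E} := ⟨_, rfl⟩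
  rw [← hI]
  rw [← hI] at hiff
  refine ⟨((Ideal.Quotient.mk I).toAddMonoidHom.comp lam.toAddMonoidHom).comp
      (PowerSeries.constantCoeff (R := unitBall E)).toAddMonoidHom, fun a r => ?_, fun y => ?_, fun r => ?_⟩
  · -- `𝒪_F`-linearity
    change Ideal.Quotient.mk I (lam (PowerSeries.constantCoeff (PowerSeries.C (algebraMap 𝒪[F] (unitBall E) a) * r))) =
      a • Ideal.Quotient.mk I (lam (PowerSeries.constantCoeff r))
    rw [map_mul, PowerSeries.constantCoeff_C, ← Algebra.smul_def, map_smul, smul_eq_mul, map_mul, Algebra.smul_def,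
      Ideal.Quotient.algebraMap_eq]
  · -- surjectivity
    obtain ⟨t, rfl⟩ := Ideal.Quotient.mk_surjective y
    obtain ⟨c, hc⟩ := hsurj t
    refine ⟨PowerSeries.C c, ?_⟩
    change Ideal.Quotient.mk I (lam (PowerSeries.constantCoeff (PowerSeries.C c))) = Ideal.Quotient.mk I t
    rw [PowerSeries.constantCoeff_C, hc]
  · -- exactness in the middle
    change _ ↔ Ideal.Quotient.mk I (lam (PowerSeries.constantCoeff r)) = 0
    rw [Ideal.Quotient.eq_zero_iff_mem, ← hiff]
    constructor
    · rintro ⟨β, -, rfl⟩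
      refine ⟨PowerSeries.constantCoeff (relLogDerivSeries hπ E hq hE hσ₀ β), ?_⟩
      rw [constantCoeff_relUnitCoordTwo, algebraMap_LTCoeff_eq]
    · rintro ⟨c, hc⟩
      obtain ⟨β, hβ1, hβ⟩ := exists_principal_relUnitCoordTwo_eq hπ E hq hE hσ₀ u hu hm r c (by rw [hc, algebraMap_LTCoeff_eq])
      exact ⟨β, hβ1, hβ⟩

/-- ★ **Left exactness** (`char F = 0`): under the same hypotheses the principal `β` with `r_β = r` is UNIQUE — `β ↦ r_β` is injective
on principal units because `c = u·φ(c) ⇒ c = 0` when `u^{[E:F]} ≠ 1` (`N < ∞`). [cite: deShalit1987, Ch. I §3.7 Theorem] -/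
theorem existsUnique_principal_of_exists [CharZero F] (u : (LTCoeff F)ˣ) (hu : LTCoeff.of F π = residueFieldCard F * u)
    (hud : (u : LTCoeff F) ^ Module.finrank F E ≠ 1) (r : PowerSeries (unitBall E))
    (h : ∃ β : RelNormCoherentUnits hπ E,
      ‖((β.val 0 : unitBall (E ⊔ ltField π 0 : IntermediateField F (AlgebraicClosure F))) :
        (E ⊔ ltField π 0 : IntermediateField F (AlgebraicClosure F))) - 1‖ < 1 ∧
      relUnitCoordTwo hπ E hq hE hσ₀ u hu β = r) :
    ∃! β : RelNormCoherentUnits hπ E,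
      ‖((β.val 0 : unitBall (E ⊔ ltField π 0 : IntermediateField F (AlgebraicClosure F))) :
        (E ⊔ ltField π 0 : IntermediateField F (AlgebraicClosure F))) - 1‖ < 1 ∧
      relUnitCoordTwo hπ E hq hE hσ₀ u hu β = r := by
  obtain ⟨β, hβ1, hβ⟩ := h
  refine ⟨β, ⟨hβ1, hβ⟩, fun β' hβ' => ?_⟩
  have hinj : ∀ c : unitBall E, c = algebraMap (LTCoeff F) (unitBall E) (u : LTCoeff F) *
      (frobUnitBall E σ₀ : unitBall E →+* unitBall E) c → c = 0 :=
    fun c hc => eq_zero_of_eq_mul_frobUnitBall E σ₀ (u : LTCoeff F) hud c hc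
  exact (eq_of_relUnitCoordTwo_eq_of_norm_sub_one_lt hπ E hq hE hσ₀ u hu hinj hβ1 hβ'.1 (hβ.trans hβ'.2.symm)).symm

end RelativeExactSequenceTwo

end Literature.NumberTheory.GaloisRepresentations
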